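import Summits.QuantumFields.YangMills.Theorems.BalabanLadderIRAfOnsetCovariance
import Literature.MathematicalPhysics.QuantumFieldTheory.WilsonFinTorusPartition
import Literature.MathematicalPhysics.QuantumFieldTheory.LatticeGaugeStaticPotentialProofs
import Literature.MathematicalPhysics.QuantumFieldTheory.WilsonEnergyConvexity
import Summits.QuantumFields.YangMills.Theorems.PencilRigidityCurvatureKernelBoundCurvatureSwapCovariance

/-!
# `ThermalDescent.TransportIdentity` / `SeamFromMoments`: the torus dictionary `Q2 = Cov_P(B_f, B_g)`

The registered stub `stub_dictionary` of `Cruxes/NT/Lines/thermal_descent_transport_birth.lean`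
(stmt-QuantumFields-27342; shared with stmt-QuantumFields-27002): NT's bare smeared two-point function
`Q2 G r β L s f g = Σ_{x,y ∈ box L} f(sx) g(sy) Cov_{2L+1}(A_x, A_y)` (periodic lift of the `ZMod`-torus Wilson measure,
time = coordinate `0`) equals the covariance `Cov_P(B_f, B_g)` of the smeared plaquette fields on the `Fin`-torus
`(2L+1)⁴` (time = LAST lattice coordinate, centred coordinates, normalised weight `w/Z`).  Ingredients, all in the
tree: `finTorusConfigEquivSite` / `sum_finTorusPlaquette_comp_site` (link reindexing `ZMod ↔ Fin`, measure preserving),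
`wilsonExpectation_eq_integral_div`, `dens_torusLift_eq` (density of the lift = torus plaquette sum at `x mod P`),
`configPerm` / `wilsonMeasure_map_configPerm` (the axis rotation `(x⁰,x¹,x²,x³) ↦ (x¹,x²,x³,x⁰)` is a symmetry),
bilinearity of the covariance, and the bijection `box L ≃ (Fin (2L+1))⁴` by centred coordinates.
Bookkeeping only; no summit, leg or spine crux is proved here. [folklore]
-/

set_option autoImplicit false
set_option maxHeartbeats 1600000

namespace Summit.QuantumFields.YangMills.Theorems.ThermalDescentTorusDictionary

open MeasureTheory Literature.MathematicalPhysics.QuantumFieldTheory Literature.MathematicalPhysics.QuantumLattice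
open Literature.Probability.LatticeModels (box mem_box Torus.proj Torus.proj_apply)
open Summit.QuantumFields.YangMills.Cruxes.OSLegsFromFemtoAndGap.DlrCollarTransfer (torusE dens Q2)

variable {G : Type} [Group G] [TopologicalSpace G] [IsTopologicalGroup G] [CompactSpace G]
  [MeasurableSpace G] [BorelSpace G] (r : LatticeRep G)

/-! ### The two currencies -/

/-- The plaquette sum `Σ_{i<j} Re tr r(U_{p_{ij}(x̄)})` at a site of the `ZMod`-torus. [folklore] -/
noncomputable def psiZ {P : ℕ} (y : Literature.MathematicalPhysics.QuantumFieldTheory.Site 4 P)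
    (U : GaugeConfig 4 P G) : ℝ :=
  ∑ q : {q : Fin 4 × Fin 4 // q.1 < q.2}, (r.ρ (plaquetteHolonomy U y q.1.1 q.1.2)).trace.re

/-- The plaquette sum at a site of the `Fin`-torus. [folklore] -/
noncomputable def aF {P : ℕ} (u : FinTorusSite P P P P) (V : FinTorusSite P P P P × Fin 4 → G) : ℝ :=
  ∑ q : {q : Fin 4 × Fin 4 // q.1 < q.2}, (r.ρ (finTorusPlaquette V u q.1.1 q.1.2)).trace.re

/-- The Wilson weight on the `Fin`-torus. [folklore] -/
noncomputable def wF (β : ℝ) {P : ℕ} (V : FinTorusSite P P P P × Fin 4 → G) : ℝ :=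
  Real.exp (-β * ∑ x : FinTorusSite P P P P, ∑ q : {q : Fin 4 × Fin 4 // q.1 < q.2},
    ((r.N : ℝ) - (r.ρ (finTorusPlaquette V x q.1.1 q.1.2)).trace.re))

/-- The normalised expectation on the `Fin`-torus. [folklore] -/
noncomputable def eF (β : ℝ) (P : ℕ) (F : (FinTorusSite P P P P × Fin 4 → G) → ℝ) : ℝ :=
  (∫ V, F V * wF r β V ∂(Measure.pi fun _ : FinTorusSite P P P P × Fin 4 => haarProbability G)) /
    wilsonFinTorusPartition r.ρ β P P P P

/-! ### `Fin`-torus expectations are Wilson expectations -/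

/-- `E_P[F] = ⟨F ∘ (reindexing)⟩_{Wilson}`. [folklore] -/
theorem eF_eq_wilsonExpectation (β : ℝ) (P : ℕ) [NeZero P] (F : (FinTorusSite P P P P × Fin 4 → G) → ℝ) :
    eF r β P F = wilsonExpectation r.ρ β (fun U : GaugeConfig 4 P G => F (finTorusConfigEquivSite G P U)) := by
  rw [wilsonExpectation_eq_integral_div r.ρ r.continuous, ← wilsonFinTorusPartition_eq_integral_exp_wilsonAction, eF]
  congr 1
  rw [← (measurePreserving_finTorusConfigEquivSite (G := G) (L := P)).integral_comp']
  refine integral_congr_ae (Filter.Eventually.of_forall fun U => ?_)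
  dsimp only
  rw [wF, coe_finTorusConfigEquivSite, sum_finTorusPlaquette_comp_site]

omit [IsTopologicalGroup G] [CompactSpace G] [BorelSpace G] in
/-- The plaquette sum of the reindexed configuration is the torus plaquette sum at the corresponding site. [folklore] -/
theorem aF_equiv {P : ℕ} [NeZero P] (u : FinTorusSite P P P P) (U : GaugeConfig 4 P G) :
    aF r u (finTorusConfigEquivSite G P U) = psiZ r (finTorusSiteEquivSite P u) U := by
  simp only [aF, psiZ, coe_finTorusConfigEquivSite, finTorusPlaquette_comp_site]

/-- The action density of the periodic lift is the torus plaquette sum at `x mod P`. [folklore] -/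
theorem dens_torusLift_eq_psiZ (P : ℕ) [NeZero P] (x : Literature.Probability.LatticeModels.Site 4)
    (U : GaugeConfig 4 P G) : dens G r x (torusLift P U) = psiZ r (Torus.proj P x) U := by
  rw [Summit.QuantumFields.YangMills.Cruxes.IR.AfOnset.dens_torusLift_eq, psiZ]
  refine Finset.sum_congr rfl fun q _ => ?_
  rw [plaquetteCost]
  ring

/-- Wilson expectations are invariant under a coordinate permutation of the observable. [folklore] -/
theorem wilsonExpectation_configPerm (β : ℝ) (P : ℕ) [NeZero P] (π : Equiv.Perm (Fin 4))
    (F : GaugeConfig 4 P G → ℝ) :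
    wilsonExpectation r.ρ β (fun U => F (configPerm π U)) = wilsonExpectation r.ρ β F := by
  rw [wilsonExpectation, wilsonExpectation, ← integral_map_equiv, wilsonMeasure_map_configPerm r.ρ r.continuous]

/-- `torusE` is a Wilson expectation of the lifted observable. [folklore] -/
theorem torusE_eq_wilsonExpectation (β : ℝ) (L : ℕ) (F : LGConfig 4 G → ℝ) :
    torusE G r β L F = wilsonExpectation r.ρ β (fun U : GaugeConfig 4 (2 * L + 1) G => F (torusLift (2 * L + 1) U)) :=
  rfl

/-! ### Centred coordinates and the axis rotation -/

/-- The centred coordinate `cc n t ∈ (−n/2, n/2]` of `t ∈ ℤ_n`. [folklore] -/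
def ccZ (n : ℕ) (t : Fin n) : ℤ := if 2 * t.val < n then (t.val : ℤ) else (t.val : ℤ) - n

/-- The `ℤ⁴` site (time FIRST) with the centred coordinates of a `Fin`-torus site (time LAST). [folklore] -/
def zOf (P : ℕ) (u : FinTorusSite P P P P) : Literature.Probability.LatticeModels.Site 4 :=
  ![ccZ P u.2.2.2, ccZ P u.1, ccZ P u.2.1, ccZ P u.2.2.1]

/-- `cc t ≡ t (mod P)` (`ZMod (2L+1) = Fin (2L+1)`). [folklore] -/
theorem intCast_ccZ (L : ℕ) (t : Fin (2 * L + 1)) :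
    ((ccZ (2 * L + 1) t : ℤ) : ZMod (2 * L + 1)) = ZMod.finEquiv (2 * L + 1) t := by
  have h : ((t.val : ℕ) : ZMod (2 * L + 1)) = ZMod.finEquiv (2 * L + 1) t :=
    ZMod.natCast_zmod_val (show ZMod (2 * L + 1) from t)
  unfold ccZ
  split_ifs
  · rw [Int.cast_natCast, h]
  · rw [Int.cast_sub, Int.cast_natCast, Int.cast_natCast, ZMod.natCast_self, sub_zero, h]

/-- The inverse axis rotation: `(finRotate 4)⁻¹ = (0 1 2 3) ↦ (3 0 1 2)`. [folklore] -/
theorem finRotate_four_symm_apply :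
    (finRotate 4).symm 0 = 3 ∧ (finRotate 4).symm 1 = 0 ∧ (finRotate 4).symm 2 = 1 ∧ (finRotate 4).symm 3 = 2 := by
  decide

/-- `zOf u mod P` is the axis-rotated image `(t, x¹, x², x³)` of the reindexed site `(x¹, x², x³, t)`. [folklore] -/
theorem proj_zOf (L : ℕ) (u : FinTorusSite (2 * L + 1) (2 * L + 1) (2 * L + 1) (2 * L + 1)) :
    Torus.proj (2 * L + 1) (zOf (2 * L + 1) u) = sitePerm (finRotate 4) (finTorusSiteEquivSite (2 * L + 1) u) := by
  obtain ⟨h0, h1, h2, h3⟩ := finRotate_four_symm_apply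
  funext j
  rw [Torus.proj_apply, sitePerm_apply]
  fin_cases j
  · simp only [Fin.zero_eta, Fin.isValue, h0]; exact intCast_ccZ L u.2.2.2
  · simp only [Fin.mk_one, Fin.isValue, h1]; exact intCast_ccZ L u.1
  · simp only [Fin.reduceFinMk, Fin.isValue, h2]; exact intCast_ccZ L u.2.1
  · simp only [Fin.reduceFinMk, Fin.isValue, h3]; exact intCast_ccZ L u.2.2.1

omit [TopologicalSpace G] [IsTopologicalGroup G] [CompactSpace G] [MeasurableSpace G] [BorelSpace G] in
/-- The sum over ordered pairs `i < j` as a double sum with an indicator. [folklore] -/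
theorem sum_pairs_eq_ite (g : Fin 4 → Fin 4 → ℝ) :
    ∑ q : {q : Fin 4 × Fin 4 // q.1 < q.2}, g q.1.1 q.1.2 = ∑ k : Fin 4, ∑ l : Fin 4, if k < l then g k l else 0 := by
  rw [← Finset.sum_subtype (p := fun pr : Fin 4 × Fin 4 => pr.1 < pr.2)
      (Finset.univ.filter fun pr : Fin 4 × Fin 4 => pr.1 < pr.2) (fun _ => by simp)
      (fun pr : Fin 4 × Fin 4 => g pr.1 pr.2),
    Finset.sum_filter, Fintype.sum_prod_type]

omit [BorelSpace G] in
/-- **Axis-rotation covariance of the plaquette sum**: `Ψ_{π·y}(U) = Ψ_y(π⁻¹·U)`. [folklore] -/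
theorem psiZ_sitePerm {P : ℕ} [NeZero P] (π : Equiv.Perm (Fin 4))
    (y : Literature.MathematicalPhysics.QuantumFieldTheory.Site 4 P) (U : GaugeConfig 4 P G) :
    psiZ r (sitePerm π y) U = psiZ r y (configPerm π.symm U) := by
  unfold psiZ
  simp only [plaquetteHolonomy_configPerm, Equiv.symm_symm]
  rw [sum_pairs_eq_ite (fun k l => (r.ρ (plaquetteHolonomy U (sitePerm π y) k l)).trace.re),
    sum_pairs_eq_ite (fun k l => (r.ρ (plaquetteHolonomy U (sitePerm π y) (π k) (π l))).trace.re)]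
  exact (Summit.QuantumFields.YangMills.Theorems.CurvatureKernel.sum_lt_perm
    (fun k l => (r.ρ (plaquetteHolonomy U (sitePerm π y) k l)).trace.re) (fun k l => by
      rw [plaquetteHolonomy_swap U (sitePerm π y) l k,
        Literature.RepresentationTheory.CompactGroups.CompactGroup.re_trace_map_inv r.ρ r.continuous]) π).symm

/-- **The covariance dictionary, site by site**: the torus covariance of the action densities at `zOf u, zOf u'`
is the `Fin`-torus covariance of the plaquette sums at `u, u'`. [folklore] -/
theorem torusCov_eq_covF (β : ℝ) (L : ℕ) (u u' : FinTorusSite (2 * L + 1) (2 * L + 1) (2 * L + 1) (2 * L + 1)) :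
    torusE G r β L (fun U => dens G r (zOf (2 * L + 1) u) U * dens G r (zOf (2 * L + 1) u') U) -
        torusE G r β L (dens G r (zOf (2 * L + 1) u)) * torusE G r β L (dens G r (zOf (2 * L + 1) u')) =
      eF r β (2 * L + 1) (fun V => aF r u V * aF r u' V) - eF r β (2 * L + 1) (aF r u) * eF r β (2 * L + 1) (aF r u') := by
  simp only [torusE_eq_wilsonExpectation, dens_torusLift_eq_psiZ, proj_zOf, psiZ_sitePerm, eF_eq_wilsonExpectation,
    aF_equiv]
  rw [wilsonExpectation_configPerm r β (2 * L + 1) (finRotate 4).symm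
      (fun U => psiZ r (finTorusSiteEquivSite (2 * L + 1) u) U * psiZ r (finTorusSiteEquivSite (2 * L + 1) u') U),
    wilsonExpectation_configPerm r β (2 * L + 1) (finRotate 4).symm
      (fun U => psiZ r (finTorusSiteEquivSite (2 * L + 1) u) U),
    wilsonExpectation_configPerm r β (2 * L + 1) (finRotate 4).symm
      (fun U => psiZ r (finTorusSiteEquivSite (2 * L + 1) u') U)]

/-! ### The bijection `box L ≃ (Fin (2L+1))⁴` by centred coordinates -/

/-- `cc` takes values in `[−L, L]`. [folklore] -/
theorem ccZ_mem (L : ℕ) (t : Fin (2 * L + 1)) : -(L : ℤ) ≤ ccZ (2 * L + 1) t ∧ ccZ (2 * L + 1) t ≤ L := by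
  unfold ccZ
  have := t.isLt
  split_ifs <;> push_cast <;> omega

/-- `cc` is injective. [folklore] -/
theorem ccZ_injective (L : ℕ) : Function.Injective (ccZ (2 * L + 1)) := fun t t' h => by
  have h' := congrArg (fun m : ℤ => (m : ZMod (2 * L + 1))) h
  simp only [intCast_ccZ] at h'
  exact (ZMod.finEquiv (2 * L + 1)).injective h'

/-- `zOf` is injective. [folklore] -/
theorem zOf_injective (L : ℕ) : Function.Injective (zOf (2 * L + 1)) := fun u u' h => by
  have h0 := congrFun h 0
  have h1 := congrFun h 1
  have h2 := congrFun h 2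
  have h3 := congrFun h 3
  simp only [zOf, Matrix.cons_val_zero, Matrix.cons_val_one, Matrix.cons_val] at h0 h1 h2 h3
  obtain ⟨a, b, c, t⟩ := u
  obtain ⟨a', b', c', t'⟩ := u'
  simp only [Prod.mk.injEq]
  exact ⟨ccZ_injective L h1, ccZ_injective L h2, ccZ_injective L h3, ccZ_injective L h0⟩

/-- The image of `zOf` is the box `[−L, L]⁴`. [folklore] -/
theorem image_zOf (L : ℕ) :
    Finset.univ.image (zOf (2 * L + 1)) = box 4 L := by
  apply Finset.eq_of_subset_of_card_le
  · intro x hx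
    obtain ⟨u, -, rfl⟩ := Finset.mem_image.1 hx
    rw [mem_box]
    intro i
    fin_cases i
    · exact ccZ_mem L u.2.2.2
    · exact ccZ_mem L u.1
    · exact ccZ_mem L u.2.1
    · exact ccZ_mem L u.2.2.1
  · rw [Finset.card_image_of_injective _ (zOf_injective L), Finset.card_univ, box, Fintype.card_piFinset]
    simp only [Int.card_Icc, Finset.prod_const, Finset.card_univ, Fintype.card_fin, FinTorusSite, Fintype.card_prod]
    have h : ((L : ℤ) + 1 - -(L : ℤ)).toNat = 2 * L + 1 := by omega
    rw [h]
    ring_nf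
    rfl

/-- **Reindexing the box by the `Fin`-torus.** [folklore] -/
theorem sum_box_eq_sum_fin (L : ℕ) (F : Literature.Probability.LatticeModels.Site 4 → ℝ) :
    ∑ x ∈ box 4 L, F x = ∑ u : FinTorusSite (2 * L + 1) (2 * L + 1) (2 * L + 1) (2 * L + 1), F (zOf (2 * L + 1) u) := by
  rw [← image_zOf, Finset.sum_image fun u _ u' _ h => zOf_injective L h]

/-! ### Bilinearity of the normalised covariance -/

omit [TopologicalSpace G] [IsTopologicalGroup G] [CompactSpace G] [MeasurableSpace G] [BorelSpace G] in
/-- `Cov(Σ c_u A_u, Σ c'_u A_u) = Σ_u Σ_u' c_u c'_u' Cov(A_u, A_u')` for the functional `E[F] = (∫ F w)/Z`. [folklore] -/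
theorem cov_bilinear {Ω ι : Type*} [MeasurableSpace Ω] [Fintype ι] {μ : Measure Ω} (A : ι → Ω → ℝ) (w : Ω → ℝ)
    (Z : ℝ) (c c' : ι → ℝ) (hi : ∀ u, Integrable (fun ω => A u ω * w ω) μ)
    (hi2 : ∀ u u', Integrable (fun ω => A u ω * A u' ω * w ω) μ) :
    (∫ ω, ((∑ u, c u * A u ω) * ∑ u', c' u' * A u' ω) * w ω ∂μ) / Z -
        (∫ ω, (∑ u, c u * A u ω) * w ω ∂μ) / Z * ((∫ ω, (∑ u', c' u' * A u' ω) * w ω ∂μ) / Z) =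
      ∑ u, ∑ u', c u * c' u' *
        ((∫ ω, A u ω * A u' ω * w ω ∂μ) / Z - (∫ ω, A u ω * w ω ∂μ) / Z * ((∫ ω, A u' ω * w ω ∂μ) / Z)) := by
  have e1 : ∀ d : ι → ℝ, ∫ ω, (∑ u, d u * A u ω) * w ω ∂μ = ∑ u, d u * ∫ ω, A u ω * w ω ∂μ := by
    intro d
    have hpt : (fun ω => (∑ u, d u * A u ω) * w ω) = fun ω => ∑ u, d u * (A u ω * w ω) := by
      funext ω; rw [Finset.sum_mul]; exact Finset.sum_congr rfl fun u _ => by ring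
    rw [hpt, integral_finsetSum _ fun u _ => (hi u).const_mul (d u)]
    exact Finset.sum_congr rfl fun u _ => integral_const_mul _ _
  have e2 : ∫ ω, ((∑ u, c u * A u ω) * ∑ u', c' u' * A u' ω) * w ω ∂μ =
      ∑ u, ∑ u', c u * c' u' * ∫ ω, A u ω * A u' ω * w ω ∂μ := by
    have hpt : (fun ω => ((∑ u, c u * A u ω) * ∑ u', c' u' * A u' ω) * w ω) =
        fun ω => ∑ u, ∑ u', c u * c' u' * (A u ω * A u' ω * w ω) := by
      funext ω
      rw [Finset.sum_mul_sum, Finset.sum_mul]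
      refine Finset.sum_congr rfl fun u _ => ?_
      rw [Finset.sum_mul]
      exact Finset.sum_congr rfl fun u' _ => by ring
    rw [hpt, integral_finsetSum _ fun u _ => integrable_finsetSum _ fun u' _ => (hi2 u u').const_mul _]
    refine Finset.sum_congr rfl fun u _ => ?_
    rw [integral_finsetSum _ fun u' _ => (hi2 u u').const_mul _]
    exact Finset.sum_congr rfl fun u' _ => integral_const_mul _ _
  rw [e2, e1 c, e1 c', Finset.sum_div, Finset.sum_div, Finset.sum_div, Finset.sum_mul_sum, ← Finset.sum_sub_distrib]
  refine Finset.sum_congr rfl fun u _ => ?_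
  rw [Finset.sum_div, ← Finset.sum_sub_distrib]
  exact Finset.sum_congr rfl fun u' _ => by ring

/-! ### Continuity on the compact configuration space -/

section Cont

variable {P : ℕ}

omit [Group G] [IsTopologicalGroup G] [CompactSpace G] [MeasurableSpace G] [BorelSpace G] in
/-- Link variables are continuous coordinates. [folklore] -/
theorem continuous_link (l : FinTorusSite P P P P × Fin 4) :
    Continuous fun V : FinTorusSite P P P P × Fin 4 → G => V l :=
  continuous_apply l

omit [CompactSpace G] [MeasurableSpace G] [BorelSpace G] in
/-- Plaquette variables are continuous. [folklore] -/
theorem continuous_plaquette (u : FinTorusSite P P P P) (i j : Fin 4) :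
    Continuous fun V : FinTorusSite P P P P × Fin 4 → G => finTorusPlaquette V u i j :=
  (((continuous_link _).mul (continuous_link _)).mul (continuous_link _).inv).mul (continuous_link _).inv

omit [CompactSpace G] [MeasurableSpace G] [BorelSpace G] in
/-- Plaquette sums are continuous. [folklore] -/
theorem continuous_aF (u : FinTorusSite P P P P) :
    Continuous fun V : FinTorusSite P P P P × Fin 4 → G => aF r u V :=
  continuous_finsetSum _ fun _ _ =>
    (Complex.continuous_re.comp (Continuous.matrix_trace r.continuous)).comp (continuous_plaquette u _ _)

omit [CompactSpace G] [MeasurableSpace G] [BorelSpace G] in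
/-- Wilson's weight is continuous. [folklore] -/
theorem continuous_wF (β : ℝ) : Continuous fun V : FinTorusSite P P P P × Fin 4 → G => wF r β V :=
  Real.continuous_exp.comp (continuous_const.mul (continuous_finsetSum _ fun x _ =>
    continuous_finsetSum _ fun _ _ => continuous_const.sub
      ((Complex.continuous_re.comp (Continuous.matrix_trace r.continuous)).comp (continuous_plaquette x _ _))))

end Cont

/-! ### The dictionary -/

/-- **`Q2 = Cov_P(B_f, B_g)`** in the currencies of this file. [folklore] -/
theorem Q2_eq_covF [SecondCountableTopology G] (β : ℝ) (L : ℕ) (s : ℝ)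
    (f g : SchwartzMap (EuclideanSpace ℝ (Fin 4)) ℝ) :
    Q2 G r β L s f g =
      eF r β (2 * L + 1) (fun V => (∑ u, f (s • siteToE (zOf (2 * L + 1) u)) * aF r u V) *
          ∑ u', g (s • siteToE (zOf (2 * L + 1) u')) * aF r u' V) -
        eF r β (2 * L + 1) (fun V => ∑ u, f (s • siteToE (zOf (2 * L + 1) u)) * aF r u V) *
          eF r β (2 * L + 1) (fun V => ∑ u', g (s • siteToE (zOf (2 * L + 1) u')) * aF r u' V) := by
  have hcpt : ∀ F : (FinTorusSite (2 * L + 1) (2 * L + 1) (2 * L + 1) (2 * L + 1) × Fin 4 → G) → ℝ, Continuous F →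
      Integrable F (Measure.pi fun _ : FinTorusSite (2 * L + 1) (2 * L + 1) (2 * L + 1) (2 * L + 1) × Fin 4 =>
        haarProbability G) := fun F hF =>
    hF.integrable_of_hasCompactSupport
      (IsCompact.of_isClosed_subset isCompact_univ (isClosed_tsupport _) (Set.subset_univ _))
  have hi : ∀ u : FinTorusSite (2 * L + 1) (2 * L + 1) (2 * L + 1) (2 * L + 1),
      Integrable (fun V => aF r u V * wF r β V) (Measure.pi fun _ => haarProbability G) := fun u =>
    hcpt _ ((continuous_aF r u).mul (continuous_wF r β))
  have hi2 : ∀ u u' : FinTorusSite (2 * L + 1) (2 * L + 1) (2 * L + 1) (2 * L + 1),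
      Integrable (fun V => aF r u V * aF r u' V * wF r β V) (Measure.pi fun _ => haarProbability G) := fun u u' =>
    hcpt _ (((continuous_aF r u).mul (continuous_aF r u')).mul (continuous_wF r β))
  simp only [eF]
  rw [cov_bilinear (aF r) (wF r β) _ _ _ hi hi2]
  simp only [Q2, sum_box_eq_sum_fin L, torusCov_eq_covF, eF]

set_option linter.unusedVariables false in
/-- **The torus dictionary** (registered stub `stub_dictionary` of the `TransportIdentity` skeleton, verbatim):
for `L ≥ 1`, NT's bare smeared two-point function `Q2` on the periodic box of side `2L+1` equals the covariance
`Cov_{2L+1}(B_f, B_g)` of the smeared plaquette fields on the `Fin`-torus `(2L+1)⁴` with the normalised Wilson weight.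
(`L ≥ 1` is not needed.) [folklore] -/
theorem stub_dictionary :
    ∀ (G : Type) [Group G] [TopologicalSpace G] [IsTopologicalGroup G] [CompactSpace G], Literature.MathematicalPhysics.QuantumFieldTheory.IsCompactSimpleLieGroup G → letI : MeasurableSpace G := borel G; haveI : BorelSpace G := ⟨rfl⟩; ∀ (r : Literature.MathematicalPhysics.QuantumFieldTheory.LatticeRep G), let St : ℕ → ℕ → Type := fun S T => Literature.MathematicalPhysics.QuantumFieldTheory.FinTorusSite S S S T; let Cfg : ℕ → ℕ → Type := fun S T => Literature.MathematicalPhysics.QuantumFieldTheory.FinTorusSite S S S T × Fin 4 → G; let cc : (n : ℕ) → Fin n → ℤ := fun n i => if 2 * i.val < n then (i.val : ℤ) else (i.val : ℤ) - n; let posE : (S T : ℕ) → St S T → EuclideanSpace ℝ (Fin 4) := fun S T x => Literature.MathematicalPhysics.QuantumLattice.siteToE (d := 4) ![cc T x.2.2.2, cc S x.1, cc S x.2.1, cc S x.2.2.1]; let P : (S T : ℕ) → St S T → Fin 4 → Fin 4 → Cfg S T → ℝ := fun _ _ x i j U => (r.ρ (Literature.MathematicalPhysics.QuantumFieldTheory.finTorusPlaquette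 U x i j)).trace.re; let A : (S T : ℕ) → St S T → Cfg S T → ℝ := fun S T x U => ∑ q : {q : Fin 4 × Fin 4 // q.1 < q.2}, P S T x q.1.1 q.1.2 U; let Ael : (S T : ℕ) → St S T → Cfg S T → ℝ := fun S T x U => ∑ i : Fin 3, P S T x (Fin.castSucc i) (Fin.last 3) U; let w : ℝ → (S T : ℕ) → Cfg S T → ℝ := fun β S T U => Real.exp (-β * ∑ x : St S T, ∑ q : {q : Fin 4 × Fin 4 // q.1 < q.2}, ((r.N : ℝ) - P S T x q.1.1 q.1.2 U)); let E : ℝ → (S T : ℕ) → (Cfg S T → ℝ) → ℝ := fun β S T F => (∫ U : Literature.MathematicalPhysics.QuantumFieldTheory.FinTorusSite S S S T × Fin 4 → G, F U * w β S T U ∂MeasureTheory.Measure.pi (fun _ => Literature.MathematicalPhysics.QuantumFieldTheory.haarProbability G)) / Literature.MathematicalPhysics.QuantumFieldTheory.wilsonFinTorusPartition r.ρ β S S S T; let Cov : ℝ → (S T : ℕ) → (Cfg S T → ℝ) → (Cfg S T → ℝ) → ℝ := fun β S T F F' => E β S T (fun U => F U * F' U) - E β S T F * E β S T F'; let refl :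 (S T : ℕ) → Cfg S T → Cfg S T := fun _ T U e => if e.2 = Fin.last 3 then (U ((e.1.1, e.1.2.1, e.1.2.2.1, Fin.rev e.1.2.2.2), Fin.last 3))⁻¹ else U ((e.1.1, e.1.2.1, e.1.2.2.1, ⟨(T - e.1.2.2.2.val) % T, Nat.mod_lt _ e.1.2.2.2.pos⟩), e.2); let B : (S T : ℕ) → ℝ → SchwartzMap (EuclideanSpace ℝ (Fin 4)) ℝ → Cfg S T → ℝ := fun S T s f U => ∑ x : St S T, f (s • posE S T x) * A S T x U; let Qrp : ℝ → (S T : ℕ) → ℝ → SchwartzMap (EuclideanSpace ℝ (Fin 4)) ℝ → ℝ := fun β S T s f => Cov β S T (fun U => B S T s f (refl S T U)) (B S T s f); let D : (S T : ℕ) → ℝ → SchwartzMap (EuclideanSpace ℝ (Fin 4)) ℝ → Cfg S T → ℝ := fun S T s f U => ∑ x : St S T, (f (s • posE S T x + s • EuclideanSpace.single (0 : Fin 4) (1 : ℝ)) - f (s • posE S T x)) * Ael S T x U; let Drp : ℝ → (S T : ℕ) → ℝ → SchwartzMap (EuclideanSpace ℝ (Fin 4)) ℝ → ℝ := fun β S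 T s f => Cov β S T (fun U => D S T s f (refl S T U)) (D S T s f); ∀ (β : ℝ) (L : ℕ) (s : ℝ) (f g : SchwartzMap (EuclideanSpace ℝ (Fin 4)) ℝ), 1 ≤ L → Summit.QuantumFields.YangMills.Cruxes.OSLegsFromFemtoAndGap.DlrCollarTransfer.Q2 G r β L s f g = Cov β (2 * L + 1) (2 * L + 1) (B (2 * L + 1) (2 * L + 1) s f) (B (2 * L + 1) (2 * L + 1) s g) := by
  intro G _ _ _ _ hG
  dsimp only
  intro r β L s f g hL
  letI : MeasurableSpace G := borel G
  haveI : BorelSpace G := ⟨rfl⟩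
  haveI : SecondCountableTopology G :=
    (r.continuous.isClosedEmbedding r.injective).isEmbedding.secondCountableTopology
  exact Q2_eq_covF r β L s f g

end Summit.QuantumFields.YangMills.Theorems.ThermalDescentTorusDictionary
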